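import Mathlib
import Summits.Schanuel.Schanuel.Statement
import Literature.NumberTheory.Transcendental.RoyCriterion
import Literature.NumberTheory.Transcendental.RoyCriterionProofs
import Literature.NumberTheory.Transcendental.RoyCriterionThm3Proofs
import HarnessLib

/-!
# Exponent bookkeeping below the Dirichlet exponent

`Summits/Schanuel/Schanuel/Theorems/SoloBlindSubDirichletCount.lean` (soloist `solo-Schanuel-blind`,
session 12; second of three files, see `SoloBlindSubDirichlet.lean`).

Pure real-analysis bookkeeping for the count behind "Roy's hypothesis is void below the Dirichlet
exponent": with Roy's profile `T₀ = ⌊N^{t₀}⌋`, `T₁ = ⌊N^{t₁}⌋`, jets of depth `K ≤ N^{s₀}` on a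
translation box of side `M ≤ N^{s₁}` in `l` directions, height `X = ⌊e^N⌋` and smallness
`e^{−N^u}`, the number of boxes needed for the `2(K+1)(M+1)^l` real jet forms has logarithm
`O(N^u log N)` per form (`jetRange_le_exp`, under Roy's side conditions in the weak form
`s₀, s₁, t₁ ≥ 0`, `u ≥ 1`, `max(s₀, t₀, s₁+t₁) ≤ u`), so that the sub-Dirichlet inequality
`s₀ + l s₁ + u < 1 + t₀ + t₁` gives, for all large `N`, more polynomials than boxes:
`ℓ^{2(K+1)(M+1)^l} < (X+1)^{(T₀+1)(T₁+1)}` (`eventually_subDirichlet_count`).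

References: D. Roy, Acta Arith. 97 (2001) 183–194, condition (1) and §5.
-/

noncomputable section

open Filter Complex MvPolynomial Metric

namespace Summit.Schanuel.Schanuel.Theorems

open Literature.NumberTheory.Transcendental

/-! ### Parameter bookkeeping below the Dirichlet exponent -/

/-- **Range of the jet forms.** For `s₀, s₁, t₁ ≥ 0`, `u ≥ 1` with `max(s₀, t₀, s₁ + t₁) ≤ u`
(Roy's side conditions in weak form), `c ≥ 0`, `a ≥ 1`, `N ≥ 3` and integers `T₀ ≤ N^{t₀}`,
`T₁ ≤ N^{t₁}`, `K ≤ N^{s₀}`, `M ≤ N^{s₁}`: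
`3 e^N · K!(T₀+1)(T₁+1)(Mc+1)^{T₀}(a^M e)^{T₁} · e^{N^u} ≤ exp(C₁ N^u log N)` with
`C₁ = 8 + 2u + log(1+c) + log a` — the size of (number of boxes for) the jet forms is
`exp(O(N^u log N))`. [this work] -/
theorem jetRange_le_exp {s₀ s₁ t₀ t₁ u : ℝ} (hs₀ : 0 ≤ s₀) (hs₁ : 0 ≤ s₁)
    (ht₁ : 0 ≤ t₁) (hu : 1 ≤ u) (hs₀u : s₀ ≤ u) (ht₀u : t₀ ≤ u) (hst : s₁ + t₁ ≤ u)
    {c a : ℝ} (hc : 0 ≤ c) (ha : 1 ≤ a) {N : ℕ} (hN : 3 ≤ N) {T₀ T₁ K M : ℕ}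
    (hT₀ : (T₀ : ℝ) ≤ (N : ℝ) ^ t₀) (hT₁ : (T₁ : ℝ) ≤ (N : ℝ) ^ t₁) (hK : (K : ℝ) ≤ (N : ℝ) ^ s₀)
    (hM : (M : ℝ) ≤ (N : ℝ) ^ s₁) :
    3 * Real.exp N * (K.factorial * ((((T₀ + 1) * (T₁ + 1) : ℕ) : ℝ) *
        (((M : ℝ) * c + 1) ^ T₀ * (a ^ M * Real.exp 1) ^ T₁))) * Real.exp ((N : ℝ) ^ u) ≤
      Real.exp ((8 + 2 * u + Real.log (1 + c) + Real.log a) * ((N : ℝ) ^ u * Real.log N)) := by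
  have hN3 : (3 : ℝ) ≤ N := by exact_mod_cast hN
  have hN1 : (1 : ℝ) ≤ N := by linarith
  have hNpos : (0 : ℝ) < N := by linarith
  have ha0 : 0 < a := by linarith
  have hlogc : 0 ≤ Real.log (1 + c) := Real.log_nonneg (by linarith)
  have hloga : 0 ≤ Real.log a := Real.log_nonneg ha
  have hL1 : 1 ≤ Real.log N := by
    rw [Real.le_log_iff_exp_le hNpos]
    have := Real.exp_one_lt_d9
    linarith
  have hL0 : 0 ≤ Real.log N := by linarith
  have hpow : ∀ s : ℝ, s ≤ u → (N : ℝ) ^ s ≤ (N : ℝ) ^ u := fun s hs =>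
    Real.rpow_le_rpow_of_exponent_le hN1 hs
  have hNE : (N : ℝ) ≤ (N : ℝ) ^ u := by
    have := hpow 1 hu
    rwa [Real.rpow_one] at this
  have hE3 : (3 : ℝ) ≤ (N : ℝ) ^ u := hN3.trans hNE
  have hE0 : (0 : ℝ) ≤ (N : ℝ) ^ u := by linarith
  have hEB : (N : ℝ) ^ u ≤ (N : ℝ) ^ u * Real.log N := le_mul_of_one_le_right hE0 hL1
  have ht₁u : t₁ ≤ u := by linarith
  have hs₁u : s₁ ≤ u := by linarith
  have hrpow_exp : ∀ s : ℝ, (N : ℝ) ^ s = Real.exp (Real.log N * s) := fun s =>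
    Real.rpow_def_of_pos hNpos s
  -- the seven factors
  have f1 : (3 : ℝ) ≤ Real.exp ((N : ℝ) ^ u * Real.log N) := by
    have := Real.add_one_le_exp ((N : ℝ) ^ u * Real.log N)
    linarith
  have f2 : Real.exp N ≤ Real.exp ((N : ℝ) ^ u * Real.log N) := Real.exp_le_exp.2 (hNE.trans hEB)
  have f3 : (K.factorial : ℝ) ≤ Real.exp (u * ((N : ℝ) ^ u * Real.log N)) := by
    have hKE : (K : ℝ) ≤ (N : ℝ) ^ u := hK.trans (hpow s₀ hs₀u)
    calc (K.factorial : ℝ) ≤ (K : ℝ) ^ K := by exact_mod_cast Nat.factorial_le_pow K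
      _ ≤ ((N : ℝ) ^ s₀) ^ K := pow_le_pow_left₀ (Nat.cast_nonneg K) hK K
      _ = Real.exp (K * (Real.log N * s₀)) := by rw [hrpow_exp s₀, ← Real.exp_nat_mul]
      _ ≤ Real.exp (u * ((N : ℝ) ^ u * Real.log N)) := by
          apply Real.exp_le_exp.2
          have h1 : Real.log N * s₀ ≤ Real.log N * u := mul_le_mul_of_nonneg_left hs₀u hL0
          have h2 : (K : ℝ) * (Real.log N * s₀) ≤ (N : ℝ) ^ u * (Real.log N * u) :=
            mul_le_mul hKE h1 (mul_nonneg hL0 hs₀) hE0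
          linarith
  have f4 : ((((T₀ + 1) * (T₁ + 1) : ℕ)) : ℝ) ≤ Real.exp (4 * ((N : ℝ) ^ u * Real.log N)) := by
    have hT₀E : (T₀ : ℝ) + 1 ≤ 2 * (N : ℝ) ^ u := by linarith [hT₀.trans (hpow t₀ ht₀u)]
    have hT₁E : (T₁ : ℝ) + 1 ≤ 2 * (N : ℝ) ^ u := by linarith [hT₁.trans (hpow t₁ ht₁u)]
    have h2E : 2 * (N : ℝ) ^ u ≤ Real.exp (2 * ((N : ℝ) ^ u * Real.log N)) := by
      have := Real.add_one_le_exp (2 * ((N : ℝ) ^ u * Real.log N))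
      linarith
    push_cast
    calc ((T₀ : ℝ) + 1) * ((T₁ : ℝ) + 1) ≤ (2 * (N : ℝ) ^ u) * (2 * (N : ℝ) ^ u) :=
          mul_le_mul hT₀E hT₁E (by positivity) (by positivity)
      _ ≤ Real.exp (2 * ((N : ℝ) ^ u * Real.log N)) * Real.exp (2 * ((N : ℝ) ^ u * Real.log N)) :=
          mul_le_mul h2E h2E (by positivity) (by positivity)
      _ = Real.exp (4 * ((N : ℝ) ^ u * Real.log N)) := by rw [← Real.exp_add]; ring_nf
  have f5 : ((M : ℝ) * c + 1) ^ T₀ ≤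
      Real.exp ((N : ℝ) ^ u * Real.log (1 + c) + u * ((N : ℝ) ^ u * Real.log N)) := by
    have h1s : (1 : ℝ) ≤ (N : ℝ) ^ s₁ := Real.one_le_rpow hN1 hs₁
    have hbase : (M : ℝ) * c + 1 ≤ Real.exp (Real.log (1 + c) + u * Real.log N) := by
      have hMc : (M : ℝ) * c ≤ (N : ℝ) ^ s₁ * c := mul_le_mul_of_nonneg_right hM hc
      calc (M : ℝ) * c + 1 ≤ (N : ℝ) ^ s₁ * c + (N : ℝ) ^ s₁ := by linarith
        _ = (1 + c) * (N : ℝ) ^ s₁ := by ring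
        _ ≤ (1 + c) * (N : ℝ) ^ u := mul_le_mul_of_nonneg_left (hpow s₁ hs₁u) (by linarith)
        _ = Real.exp (Real.log (1 + c) + u * Real.log N) := by
            rw [Real.exp_add, Real.exp_log (by linarith), hrpow_exp u, mul_comm (Real.log N) u]
    have hT₀E : (T₀ : ℝ) ≤ (N : ℝ) ^ u := hT₀.trans (hpow t₀ ht₀u)
    have hx0 : 0 ≤ Real.log (1 + c) + u * Real.log N := by positivity
    calc ((M : ℝ) * c + 1) ^ T₀ ≤ Real.exp (Real.log (1 + c) + u * Real.log N) ^ T₀ :=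
          pow_le_pow_left₀ (by positivity) hbase T₀
      _ = Real.exp (T₀ * (Real.log (1 + c) + u * Real.log N)) := by rw [← Real.exp_nat_mul]
      _ ≤ _ := by
          apply Real.exp_le_exp.2
          have := mul_le_mul_of_nonneg_right hT₀E hx0
          linarith
  have f6 : (a ^ M * Real.exp 1) ^ T₁ ≤
      Real.exp ((N : ℝ) ^ u * Real.log a + (N : ℝ) ^ u) := by
    have hbase : a ^ M * Real.exp 1 = Real.exp (M * Real.log a + 1) := by
      rw [Real.exp_add, Real.exp_nat_mul, Real.exp_log ha0]
    rw [hbase, ← Real.exp_nat_mul]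
    apply Real.exp_le_exp.2
    have hTM : (T₁ : ℝ) * M ≤ (N : ℝ) ^ u := by
      calc (T₁ : ℝ) * M ≤ (N : ℝ) ^ t₁ * (N : ℝ) ^ s₁ :=
            mul_le_mul hT₁ hM (Nat.cast_nonneg M) (by positivity)
        _ = (N : ℝ) ^ (t₁ + s₁) := by rw [Real.rpow_add hNpos]
        _ ≤ (N : ℝ) ^ u := hpow _ (by linarith)
    have hT₁E : (T₁ : ℝ) ≤ (N : ℝ) ^ u := hT₁.trans (hpow t₁ ht₁u)
    have := mul_le_mul_of_nonneg_right hTM hloga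
    nlinarith
  -- assemble
  calc 3 * Real.exp N * (K.factorial * ((((T₀ + 1) * (T₁ + 1) : ℕ) : ℝ) *
        (((M : ℝ) * c + 1) ^ T₀ * (a ^ M * Real.exp 1) ^ T₁))) * Real.exp ((N : ℝ) ^ u)
      ≤ Real.exp ((N : ℝ) ^ u * Real.log N) * Real.exp ((N : ℝ) ^ u * Real.log N) *
          (Real.exp (u * ((N : ℝ) ^ u * Real.log N)) *
            (Real.exp (4 * ((N : ℝ) ^ u * Real.log N)) *
              (Real.exp ((N : ℝ) ^ u * Real.log (1 + c) + u * ((N : ℝ) ^ u * Real.log N)) *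
                Real.exp ((N : ℝ) ^ u * Real.log a + (N : ℝ) ^ u)))) *
          Real.exp ((N : ℝ) ^ u) := by
        gcongr
    _ ≤ Real.exp ((8 + 2 * u + Real.log (1 + c) + Real.log a) * ((N : ℝ) ^ u * Real.log N)) := by
        simp only [← Real.exp_add]
        apply Real.exp_le_exp.2
        have h1 := mul_le_mul_of_nonneg_right hEB hlogc
        have h2 := mul_le_mul_of_nonneg_right hEB hloga
        nlinarith [hEB, h1, h2]

/-- **The count below the Dirichlet exponent.** Under the hypotheses of `jetRange_le_exp` and the
sub-Dirichlet inequality `s₀ + l s₁ + u < 1 + t₀ + t₁`, for all large `N` and all integers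
`T₀ = ⌊N^{t₀}⌋`, `T₁ = ⌊N^{t₁}⌋`, `K ≤ N^{s₀}`, `M ≤ N^{s₁}`, `X ≥ ⌊e^N⌋` and
`1 ≤ ℓ ≤ 3e^N · K!(T₀+1)(T₁+1)(Mc+1)^{T₀}(a^Me)^{T₁} · e^{N^u}` one has
`ℓ^{2(K+1)(M+1)^l} < (X+1)^{(T₀+1)(T₁+1)}`: there are more integer polynomials of Roy's profile
than boxes for their `2(K+1)(M+1)^l` real jet forms (`(K+1)(M+1)^l · N^u log N ≪ N^{1+t₀+t₁}`).
[this work] -/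
theorem eventually_subDirichlet_count {l : ℕ} {s₀ s₁ t₀ t₁ u : ℝ} (hs₀ : 0 ≤ s₀) (hs₁ : 0 ≤ s₁)
    (ht₁ : 0 ≤ t₁) (hu : 1 ≤ u) (hs₀u : s₀ ≤ u) (ht₀u : t₀ ≤ u)
    (hst : s₁ + t₁ ≤ u) (hdir : s₀ + l * s₁ + u < 1 + t₀ + t₁) {c a : ℝ} (hc : 0 ≤ c)
    (ha : 1 ≤ a) :
    ∀ᶠ N : ℕ in atTop, ∀ (T₀ T₁ K M X ℓ : ℕ),
      (T₀ : ℝ) ≤ (N : ℝ) ^ t₀ → (N : ℝ) ^ t₀ < T₀ + 1 → (T₁ : ℝ) ≤ (N : ℝ) ^ t₁ →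
      (N : ℝ) ^ t₁ < T₁ + 1 → (K : ℝ) ≤ (N : ℝ) ^ s₀ → (M : ℝ) ≤ (N : ℝ) ^ s₁ →
      Real.exp N < X + 1 → 0 < ℓ →
      (ℓ : ℝ) ≤ 3 * Real.exp N * (K.factorial * ((((T₀ + 1) * (T₁ + 1) : ℕ) : ℝ) *
          (((M : ℝ) * c + 1) ^ T₀ * (a ^ M * Real.exp 1) ^ T₁))) * Real.exp ((N : ℝ) ^ u) →
      ℓ ^ (2 * ((K + 1) * (M + 1) ^ l)) < (X + 1) ^ ((T₀ + 1) * (T₁ + 1)) := by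
  set C₁ : ℝ := 8 + 2 * u + Real.log (1 + c) + Real.log a with hC₁
  have hC₁0 : 0 ≤ C₁ := by
    have := Real.log_nonneg (by linarith : (1 : ℝ) ≤ 1 + c)
    have := Real.log_nonneg ha
    rw [hC₁]; linarith
  have hev := eventually_mul_rpow_mul_log_le hdir (show (0 : ℝ) ≤ 2 ^ (l + 2) * C₁ by positivity)
    one_pos
  filter_upwards [tendsto_natCast_atTop_atTop.eventually hev, eventually_ge_atTop 3] with N hN hN3
  intro T₀ T₁ K M X ℓ hT₀ hT₀' hT₁ hT₁' hK hM hX hℓ hℓle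
  have hN3r : (3 : ℝ) ≤ N := by exact_mod_cast hN3
  have hN1 : (1 : ℝ) ≤ N := by linarith
  have hNpos : (0 : ℝ) < N := by linarith
  have hN' : 2 ^ (l + 2) * C₁ * (N : ℝ) ^ (s₀ + l * s₁ + u) * Real.log N ≤
      1 * (N : ℝ) ^ (1 + t₀ + t₁) := hN
  -- (i) `log ℓ ≤ C₁ N^u log N`
  have hi : Real.log ℓ ≤ C₁ * ((N : ℝ) ^ u * Real.log N) := by
    rw [Real.log_le_iff_le_exp (by exact_mod_cast hℓ)]
    exact hℓle.trans (jetRange_le_exp hs₀ hs₁ ht₁ hu hs₀u ht₀u hst hc ha hN3 hT₀ hT₁ hK hM)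
  -- (ii) `2(K+1)(M+1)^l ≤ 2^{l+2} N^{s₀ + l s₁}`
  have hii : ((2 * ((K + 1) * (M + 1) ^ l) : ℕ) : ℝ) ≤ 2 ^ (l + 2) * (N : ℝ) ^ (s₀ + l * s₁) := by
    have h1 : (1 : ℝ) ≤ (N : ℝ) ^ s₀ := Real.one_le_rpow hN1 hs₀
    have h2 : (1 : ℝ) ≤ (N : ℝ) ^ s₁ := Real.one_le_rpow hN1 hs₁
    have hK1 : (K : ℝ) + 1 ≤ 2 * (N : ℝ) ^ s₀ := by linarith
    have hM1 : (M : ℝ) + 1 ≤ 2 * (N : ℝ) ^ s₁ := by linarith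
    have hM2 : ((M : ℝ) + 1) ^ l ≤ (2 * (N : ℝ) ^ s₁) ^ l := pow_le_pow_left₀ (by positivity) hM1 l
    have hrpow : ((N : ℝ) ^ s₁) ^ l = (N : ℝ) ^ (l * s₁) := by
      rw [← Real.rpow_natCast, ← Real.rpow_mul hNpos.le, mul_comm]
    push_cast
    calc (2 : ℝ) * (((K : ℝ) + 1) * ((M : ℝ) + 1) ^ l)
        ≤ 2 * ((2 * (N : ℝ) ^ s₀) * (2 * (N : ℝ) ^ s₁) ^ l) :=
          mul_le_mul_of_nonneg_left (mul_le_mul hK1 hM2 (by positivity) (by positivity))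
            (by norm_num)
      _ = 2 ^ (l + 2) * ((N : ℝ) ^ s₀ * (N : ℝ) ^ (l * s₁)) := by rw [mul_pow, hrpow]; ring
      _ = 2 ^ (l + 2) * (N : ℝ) ^ (s₀ + l * s₁) := by rw [← Real.rpow_add hNpos]
  -- (iii) `N^{1+t₀+t₁} < (T₀+1)(T₁+1) log(X+1)`
  have hiii : (N : ℝ) ^ (1 + t₀ + t₁) <
      (((T₀ + 1) * (T₁ + 1) : ℕ) : ℝ) * Real.log ((X : ℝ) + 1) := by
    have hX0 : (0 : ℝ) ≤ X := Nat.cast_nonneg X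
    have hlog : (N : ℝ) < Real.log ((X : ℝ) + 1) := by
      rw [Real.lt_log_iff_exp_lt (by positivity)]; exact hX
    have hlog0 : 0 ≤ Real.log ((X : ℝ) + 1) := Real.log_nonneg (by linarith)
    have e1 : (N : ℝ) ^ (1 + t₀ + t₁) = N * ((N : ℝ) ^ t₀ * (N : ℝ) ^ t₁) := by
      rw [Real.rpow_add hNpos, Real.rpow_add hNpos, Real.rpow_one]; ring
    have ht0pos : (0 : ℝ) < (N : ℝ) ^ t₀ := Real.rpow_pos_of_pos hNpos _
    have ht1pos : (0 : ℝ) < (N : ℝ) ^ t₁ := Real.rpow_pos_of_pos hNpos _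
    rw [e1]
    push_cast
    calc (N : ℝ) * ((N : ℝ) ^ t₀ * (N : ℝ) ^ t₁)
        < Real.log ((X : ℝ) + 1) * ((N : ℝ) ^ t₀ * (N : ℝ) ^ t₁) :=
          mul_lt_mul_of_pos_right hlog (by positivity)
      _ ≤ Real.log ((X : ℝ) + 1) * (((T₀ : ℝ) + 1) * ((T₁ : ℝ) + 1)) :=
          mul_le_mul_of_nonneg_left (mul_le_mul hT₀'.le hT₁'.le ht1pos.le (by positivity)) hlog0
      _ = ((T₀ : ℝ) + 1) * ((T₁ : ℝ) + 1) * Real.log ((X : ℝ) + 1) := by ring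
  -- combine and exponentiate
  have hℓr : (0 : ℝ) < ℓ := by exact_mod_cast hℓ
  have hlogℓ : 0 ≤ Real.log ℓ := Real.log_nonneg (by exact_mod_cast hℓ)
  have hmain : ((2 * ((K + 1) * (M + 1) ^ l) : ℕ) : ℝ) * Real.log ℓ <
      (((T₀ + 1) * (T₁ + 1) : ℕ) : ℝ) * Real.log ((X : ℝ) + 1) := by
    calc ((2 * ((K + 1) * (M + 1) ^ l) : ℕ) : ℝ) * Real.log ℓ
        ≤ (2 ^ (l + 2) * (N : ℝ) ^ (s₀ + l * s₁)) * (C₁ * ((N : ℝ) ^ u * Real.log N)) :=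
          mul_le_mul hii hi hlogℓ (by positivity)
      _ = 2 ^ (l + 2) * C₁ * (N : ℝ) ^ (s₀ + l * s₁ + u) * Real.log N := by
          rw [Real.rpow_add hNpos _ u]; ring
      _ ≤ 1 * (N : ℝ) ^ (1 + t₀ + t₁) := hN'
      _ < _ := by rw [one_mul]; exact hiii
  have hreal : (ℓ : ℝ) ^ (2 * ((K + 1) * (M + 1) ^ l)) < ((X : ℝ) + 1) ^ ((T₀ + 1) * (T₁ + 1)) := by
    rw [← Real.exp_log hℓr, ← Real.exp_nat_mul,
      ← Real.exp_log (by positivity : (0 : ℝ) < (X : ℝ) + 1), ← Real.exp_nat_mul, Real.exp_lt_exp]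
    exact hmain
  exact_mod_cast hreal

end Summit.Schanuel.Schanuel.Theorems

end
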